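import Mathlib
import Summits.Ventures.HodgeRepro.Tier4.Line1.RTFSetting

/-!
# Tier4/Line1/RtfUnfold — LINE L1, towards L1.2b `rtf_spectral`: continuity of `R(f)φ` and the finite unfolding

Blind re-derivation cell `pub-hodge-repro`, Tier 4 «prove the step» (README §9–§10), seat t4-L1-p4 (prover, gen 0; lead
S12132 / S12152: t4-L1-p4 = L1.2b `rtf_spectral`, Skeleton v0.8 12c8528bc811170c L434–L439 = v0.9 a06d5c6d2f1bfa47).
Generic layer `Tier4/Line1/RTFSetting.lean` (t4-plan-1), imported BY NAME.  Module 1 of 2 for L1.2b (the gate takes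
≤ 400 lines per file); module 2 = `Tier4/Line1/RtfSpectralStep.lean` (Bessel + dominated convergence).
Paper proof: proofs/t4/L1/L1.2b.md (Steps 1–2 here).

* Step 1 — `R(f)φ` for a test function `f` and a continuous `G(k)`-invariant `φ`: `φ` is bounded on `G` by any bound
  valid on `closure DG` (`norm_le_of_invariant`: the open set where the bound fails lies in the `μ`-null complement of
  `⋃ γ • DG`, `IsFundamentalDomain.ae_covers` + `IsOpenPosMeasure`), `‖R(f)φ‖ ≤ ‖f‖₁ sup ‖φ‖` (`norm_R_le`), and
  `R(f)φ` is CONTINUOUS (`continuous_R`): `f` is uniformly continuous for the right uniformity of `G`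
  (`HasCompactSupport.uniformContinuous_of_continuous` on `IsTopologicalGroup.rightUniformSpace`), and the difference
  of two translates of `f` is supported in `y • tsupport f ∪ y₀ • tsupport f`, of measure `≤ 2 μ(tsupport f)` by left
  invariance.  No local compactness, first countability or second countability of `G` is used.
* Step 2 — the FINITE UNFOLDING (`R_eq_setIntegral_finiteKernel`): for `y` in a compact `C₁`,
  `R(f)φ(y) = ∫_{DG} (∑_{γ ∈ Γ} f(y⁻¹ γ z)) φ(z) dz`, `Γ` = the rational points of the compact window
  `C₁ · tsupport f · (closure DG)⁻¹` (finite: `Gk` is discrete and closed, `finite_rational_inter`) — the integrand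
  `f(y⁻¹ h) φ(h)` vanishes a.e. outside the finitely many a.e.-disjoint translates `γ • DG`, `γ ∈ Γ`
  (`ae_covers`, `aedisjoint`, `integral_iUnion_ae`), each brought back to `DG` by the left-invariant `μ`
  (`measurePreserving_mul_left`) and the invariance of `φ`.  Mathlib's `IsFundamentalDomain.integral_eq_tsum` needs a
  COUNTABLE acting group, which a `Setting` does not provide (t4-L1-p3 S12239: `G = ℝ × D`, `D` uncountable discrete);
  the unfolding is therefore done by hand on the compact support.

Nothing here says anything about the status of the Hodge conjecture for CM abelian varieties, which is NOT proved;
HC_CM is NOT proved by anyone in this repository.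
-/

set_option autoImplicit false

noncomputable section

namespace Summit.Ventures.HodgeRepro.Tier4.Line1

open MeasureTheory Topology Filter Set
open scoped Uniformity Pointwise InnerProductSpace ComplexConjugate

namespace RTF

variable {G : Type} [Group G] [TopologicalSpace G] [IsTopologicalGroup G] [MeasurableSpace G]
  [BorelSpace G]

omit [Group G] [IsTopologicalGroup G] [MeasurableSpace G] [BorelSpace G] in
/-- the product of a test function with a continuous function is a test function. -/
theorem IsTest.mul_continuous {f φ : G → ℂ} (hf : IsTest f) (hφ : Continuous φ) :
    IsTest (fun g => f g * φ g) :=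
  ⟨hf.cont.mul hφ, hf.compact.mul_right⟩

omit [MeasurableSpace G] [BorelSpace G] in
/-- the left translate of a test function is a test function. -/
theorem IsTest.translate {f : G → ℂ} (hf : IsTest f) (y : G) : IsTest (fun h => f (y⁻¹ * h)) :=
  ⟨hf.cont.comp (continuous_const.mul continuous_id),
    hf.compact.comp_homeomorph (Homeomorph.mulLeft y⁻¹)⟩

namespace Setting

variable (S : Setting G)

/-! ### Step 1 — bounds, integrability and continuity of `R(f)φ` -/

omit [IsTopologicalGroup G] in
/-- A test function is integrable for the Haar measure `μ`. -/
theorem integrable_of_isTest {f : G → ℂ} (hf : IsTest f) : Integrable f S.μ := by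
  haveI := S.haar
  exact hf.cont.integrable_of_hasCompactSupport hf.compact

omit [IsTopologicalGroup G] [BorelSpace G] in
/-- A continuous `G(k)`-invariant function is bounded on `G` by any bound valid on `closure DG`:
the open set where the bound fails lies in the `μ`-null complement of `⋃ γ, γ • DG`. -/
theorem norm_le_of_invariant {φ : G → ℂ} (hφ : S.Invariant φ) (hc : Continuous φ) {C : ℝ}
    (hC : ∀ x ∈ closure S.DG, ‖φ x‖ ≤ C) (x : G) : ‖φ x‖ ≤ C := by
  by_contra hx
  have hx' : C < ‖φ x‖ := not_le.mp hx
  haveI := S.haar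
  have hU : IsOpen {y : G | C < ‖φ y‖} := isOpen_lt continuous_const hc.norm
  have hpos : 0 < S.μ {y : G | C < ‖φ y‖} := hU.measure_pos S.μ ⟨x, hx'⟩
  have hsub : {y : G | C < ‖φ y‖} ⊆ {y : G | ¬ ∃ g : S.Gk, g • y ∈ S.DG} := by
    intro y hy
    rintro ⟨g, hg⟩
    have h1 := hC (g • y) (subset_closure hg)
    rw [Subgroup.smul_def, smul_eq_mul, hφ g y] at h1
    exact absurd h1 (not_le.mpr hy)
  have hnull : S.μ {y : G | ¬ ∃ g : S.Gk, g • y ∈ S.DG} = 0 := ae_iff.mp S.fdG.ae_covers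
  exact absurd (measure_mono_null hsub hnull) hpos.ne'

omit [IsTopologicalGroup G] [BorelSpace G] in
/-- A continuous function is bounded on `closure DG` (compact). -/
theorem exists_bound_closure {φ : G → ℂ} (hc : Continuous φ) :
    ∃ C : ℝ, 0 ≤ C ∧ ∀ x ∈ closure S.DG, ‖φ x‖ ≤ C := by
  obtain ⟨C, hC⟩ := S.compG.exists_bound_of_continuousOn hc.continuousOn
  exact ⟨max C 0, le_max_right _ _, fun x hx => (hC x hx).trans (le_max_left _ _)⟩

omit [IsTopologicalGroup G] [BorelSpace G] in
/-- A continuous invariant function is bounded on `G`. -/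
theorem exists_bound_of_invariant {φ : G → ℂ} (hφ : S.Invariant φ) (hc : Continuous φ) :
    ∃ C : ℝ, 0 ≤ C ∧ ∀ x, ‖φ x‖ ≤ C := by
  obtain ⟨C, hC0, hC⟩ := S.exists_bound_closure hc
  exact ⟨C, hC0, fun x => S.norm_le_of_invariant hφ hc hC x⟩

/-- `R(f)φ(y) = ∫ f(y⁻¹ h) φ(h) dμ(h)` (left invariance of `μ`). -/
theorem R_eq_integral_inv_mul (f φ : G → ℂ) (y : G) :
    S.R f φ y = ∫ h, f (y⁻¹ * h) * φ h ∂S.μ := by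
  haveI := S.haar
  unfold R
  rw [← integral_mul_left_eq_self (fun h => f (y⁻¹ * h) * φ h) y]
  simp only [inv_mul_cancel_left]

omit [IsTopologicalGroup G] in
/-- the trivial bound `‖R(f)φ(y)‖ ≤ ‖f‖₁ · sup ‖φ‖`. -/
theorem norm_R_le {f φ : G → ℂ} (hf : IsTest f) {B : ℝ} (hB : ∀ x, ‖φ x‖ ≤ B) (y : G) :
    ‖S.R f φ y‖ ≤ (∫ g, ‖f g‖ ∂S.μ) * B := by
  unfold R
  calc ‖∫ g, f g * φ (y * g) ∂S.μ‖ ≤ ∫ g, ‖f g * φ (y * g)‖ ∂S.μ :=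
        norm_integral_le_integral_norm _
    _ ≤ ∫ g, ‖f g‖ * B ∂S.μ := by
        apply integral_mono_of_nonneg (Eventually.of_forall fun g => norm_nonneg _)
          ((S.integrable_of_isTest hf).norm.mul_const B)
        refine Eventually.of_forall fun g => ?_
        show ‖f g * φ (y * g)‖ ≤ ‖f g‖ * B
        rw [norm_mul]
        exact mul_le_mul_of_nonneg_left (hB _) (norm_nonneg _)
    _ = (∫ g, ‖f g‖ ∂S.μ) * B := integral_mul_const _ _

/-- `R(f)φ` is continuous on `G` for a test function `f` and a bounded continuous `φ`: `f` is uniformly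
continuous for the right uniformity of `G`, and the difference `f(y⁻¹ h) − f(y₀⁻¹ h)` is supported in
`y • tsupport f ∪ y₀ • tsupport f`, of `μ`-measure `≤ 2 μ(tsupport f)` by left invariance.  No local
compactness and no first countability of `G` are used. -/
theorem continuous_R {f φ : G → ℂ} (hf : IsTest f) (hφc : Continuous φ) {B : ℝ}
    (hB : ∀ x, ‖φ x‖ ≤ B) : Continuous (S.R f φ) := by
  haveI := S.haar
  have hB0 : 0 ≤ B := (norm_nonneg _).trans (hB 1)
  -- the uniform continuity of `f`
  letI : UniformSpace G := IsTopologicalGroup.rightUniformSpace G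
  have huc : UniformContinuous f := hf.compact.uniformContinuous_of_continuous hf.cont
  rw [continuous_iff_continuousAt]
  intro y₀
  rw [ContinuousAt, Metric.tendsto_nhds]
  intro ε hε
  set K := tsupport f with hK
  have hKc : IsCompact K := hf.compact
  have hKcl : IsClosed K := isClosed_tsupport f
  set c : ℝ := S.μ.real K with hc
  have hc0 : 0 ≤ c := measureReal_nonneg
  set δ : ℝ := ε / (2 * (B + 1) * (c + 1)) with hδ
  have hδpos : 0 < δ := by positivity
  -- an entourage for `δ`
  have hent : {p : G × G | dist (f p.1) (f p.2) < δ} ∈ 𝓤 G :=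
    huc (Metric.dist_mem_uniformity hδpos)
  rw [uniformity_eq_comap_nhds_one' G, Filter.mem_comap] at hent
  obtain ⟨U, hU, hUsub⟩ := hent
  -- the neighbourhood of `y₀`
  have hV : {y : G | y⁻¹ * y₀ ∈ U} ∈ 𝓝 y₀ := by
    have hcont : Continuous fun y : G => y⁻¹ * y₀ := continuous_inv.mul continuous_const
    exact hcont.continuousAt.preimage_mem_nhds (by rw [inv_mul_cancel]; exact hU)
  filter_upwards [hV] with y hy
  -- pointwise bound on the difference of the translates
  have hdiff : ∀ h : G, ‖f (y⁻¹ * h) - f (y₀⁻¹ * h)‖ ≤ δ := by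
    intro h
    have hmem : (y₀⁻¹ * h, y⁻¹ * h) ∈ (fun p : G × G => p.2 * p.1⁻¹) ⁻¹' U := by
      simp only [Set.mem_preimage, mul_inv_rev, inv_inv]
      convert hy using 1
      group
    have := hUsub hmem
    simp only [Set.mem_setOf_eq, dist_eq_norm] at this
    rw [norm_sub_rev]
    exact this.le
  -- the support of the difference
  have hsupp : ∀ h : G, f (y⁻¹ * h) - f (y₀⁻¹ * h) ≠ 0 → h ∈ y • K ∪ y₀ • K := by
    intro h hne
    by_contra hnot
    simp only [Set.mem_union, not_or] at hnot
    have h1 : f (y⁻¹ * h) = 0 := by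
      apply image_eq_zero_of_notMem_tsupport
      intro hmem
      exact hnot.1 (by rw [Set.mem_smul_set_iff_inv_smul_mem]; exact hmem)
    have h2 : f (y₀⁻¹ * h) = 0 := by
      apply image_eq_zero_of_notMem_tsupport
      intro hmem
      exact hnot.2 (by rw [Set.mem_smul_set_iff_inv_smul_mem]; exact hmem)
    exact hne (by rw [h1, h2, sub_zero])
  -- the set `W := y • K ∪ y₀ • K`
  set W : Set G := y • K ∪ y₀ • K with hW
  have hWm : MeasurableSet W := ((hKcl.smul y).union (hKcl.smul y₀)).measurableSet
  have hWfin : S.μ W ≠ ⊤ := by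
    refine ne_top_of_le_ne_top ?_ (measure_union_le (y • K) (y₀ • K))
    rw [measure_smul, measure_smul]
    exact ENNReal.add_ne_top.mpr ⟨hKc.measure_lt_top.ne, hKc.measure_lt_top.ne⟩
  have hWreal : S.μ.real W ≤ 2 * c := by
    calc S.μ.real W ≤ S.μ.real (y • K) + S.μ.real (y₀ • K) := measureReal_union_le _ _
      _ = 2 * c := by
          rw [hc, Measure.real, Measure.real, Measure.real, measure_smul, measure_smul]
          ring
  -- the integrals
  have hi₁ : Integrable (fun h => f (y⁻¹ * h) * φ h) S.μ :=
    S.integrable_of_isTest ((hf.translate y).mul_continuous hφc)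
  have hi₀ : Integrable (fun h => f (y₀⁻¹ * h) * φ h) S.μ :=
    S.integrable_of_isTest ((hf.translate y₀).mul_continuous hφc)
  rw [dist_eq_norm, S.R_eq_integral_inv_mul, S.R_eq_integral_inv_mul, ← integral_sub hi₁ hi₀]
  have hbound : ∀ h : G, ‖f (y⁻¹ * h) * φ h - f (y₀⁻¹ * h) * φ h‖ ≤
      W.indicator (fun _ => δ * B) h := by
    intro h
    by_cases hh : h ∈ W
    · rw [Set.indicator_of_mem hh, ← sub_mul, norm_mul]
      exact mul_le_mul (hdiff h) (hB h) (norm_nonneg _) hδpos.le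
    · rw [Set.indicator_of_notMem hh]
      have : f (y⁻¹ * h) - f (y₀⁻¹ * h) = 0 := by
        by_contra hne
        exact hh (hsupp h hne)
      rw [← sub_mul, this, zero_mul, norm_zero]
  have hind : Integrable (W.indicator fun _ : G => δ * B) S.μ :=
    (integrable_indicator_iff hWm).mpr (integrableOn_const hWfin)
  calc ‖∫ h, (f (y⁻¹ * h) * φ h - f (y₀⁻¹ * h) * φ h) ∂S.μ‖
      ≤ ∫ h, ‖f (y⁻¹ * h) * φ h - f (y₀⁻¹ * h) * φ h‖ ∂S.μ := norm_integral_le_integral_norm _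
    _ ≤ ∫ h, W.indicator (fun _ => δ * B) h ∂S.μ :=
        integral_mono_of_nonneg (Eventually.of_forall fun h => norm_nonneg _) hind
          (Eventually.of_forall hbound)
    _ = S.μ.real W * (δ * B) := by rw [integral_indicator_const _ hWm, smul_eq_mul]
    _ ≤ 2 * c * (δ * B) := by
        apply mul_le_mul_of_nonneg_right hWreal
        positivity
    _ < ε := by
        rw [hδ]
        rw [show 2 * c * (ε / (2 * (B + 1) * (c + 1)) * B) =
            ε * ((2 * c * B) / (2 * (B + 1) * (c + 1))) by ring]
        have hlt : (2 * c * B) / (2 * (B + 1) * (c + 1)) < 1 := by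
          rw [div_lt_one (by positivity)]
          nlinarith [mul_nonneg hB0 hc0]
        calc ε * ((2 * c * B) / (2 * (B + 1) * (c + 1))) < ε * 1 :=
              mul_lt_mul_of_pos_left hlt hε
          _ = ε := mul_one ε

/-! ### Step 2 — the finite unfolding `R(f)φ(y) = ∫_{DG} k_y φ` -/

omit [IsTopologicalGroup G] [BorelSpace G] in
/-- a closed discrete subset of a compact set is finite: the rational points in a compact set. -/
theorem finite_rational_inter {C : Set G} (hC : IsCompact C) :
    {γ : S.Gk | (γ : G) ∈ C}.Finite := by
  have hGk : IsDiscrete (S.Gk : Set G) := SetLike.isDiscrete_iff_discreteTopology.mpr S.discrete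
  have h1 : (C ∩ (S.Gk : Set G)).Finite :=
    (hC.inter_right S.closed).finite (hGk.mono Set.inter_subset_right)
  have h2 : {γ : S.Gk | (γ : G) ∈ C} = (Subtype.val : S.Gk → G) ⁻¹' (C ∩ (S.Gk : Set G)) := by
    ext γ
    simp only [Set.mem_setOf_eq, Set.mem_preimage, Set.mem_inter_iff]
    exact ⟨fun h => ⟨h, γ.2⟩, fun h => h.1⟩
  rw [h2]
  exact h1.preimage (Set.injOn_of_injective Subtype.val_injective)

omit [BorelSpace G] in
/-- the compact set `C₁ · tsupport f · (closure DG)⁻¹` -/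
theorem isCompact_window {f : G → ℂ} (hf : IsTest f) {C₁ : Set G} (hC₁ : IsCompact C₁) :
    IsCompact (C₁ * tsupport f * (closure S.DG)⁻¹) :=
  (hC₁.mul hf.compact).mul S.compG.inv

omit [IsTopologicalGroup G] in
/-- continuous functions are integrable on `DG` (relatively compact, `μ` finite on compacts). -/
theorem integrableOn_DG {ψ : G → ℂ} (hψ : Continuous ψ) : IntegrableOn ψ S.DG S.μ := by
  haveI := S.haar
  exact (hψ.continuousOn.integrableOn_compact' S.compG isClosed_closure.measurableSet).mono_set
    subset_closure

omit [IsTopologicalGroup G] [BorelSpace G] in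
/-- `DG` has finite measure (`closure DG` is compact, `μ` is finite on compacts). -/
theorem measure_DG_ne_top : S.μ S.DG ≠ ⊤ := by
  haveI := S.haar
  exact ne_top_of_le_ne_top S.compG.measure_lt_top.ne (measure_mono subset_closure)

omit [IsTopologicalGroup G] [BorelSpace G] in
/-- `(γ * ·) ⁻¹' (γ • DG) = DG` -/
theorem preimage_mul_smul (γ : S.Gk) (s : Set G) : (fun z => (γ : G) * z) ⁻¹' (γ • s) = s := by
  ext z
  simp only [Set.mem_preimage, Set.mem_smul_set, Subgroup.smul_def, smul_eq_mul, mul_right_inj,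
    exists_eq_right]

/-- the translation of a set integral along a rational point. -/
theorem setIntegral_smul_DG (γ : S.Gk) (F : G → ℂ) :
    ∫ h in γ • S.DG, F h ∂S.μ = ∫ z in S.DG, F ((γ : G) * z) ∂S.μ := by
  haveI := S.haar
  have := (measurePreserving_mul_left S.μ (γ : G)).setIntegral_preimage_emb
    (measurableEmbedding_mulLeft (γ : G)) F (γ • S.DG)
  rw [S.preimage_mul_smul γ S.DG] at this
  exact this.symm

/-- THE FINITE UNFOLDING.  For a test function `f`, a continuous invariant `φ`, a compact `C₁ ∋ y` and a
finite set `Γ ⊆ G(k)` containing every rational point of the window `C₁ · tsupport f · (closure DG)⁻¹`: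
`R(f)φ(y) = ∫_{DG} (∑_{γ ∈ Γ} f(y⁻¹ γ z)) φ(z) dz` — the integrand `f(y⁻¹ h) φ(h)` vanishes a.e. outside the
finitely many a.e.-disjoint translates `γ • DG`, `γ ∈ Γ` (`ae_covers`, `aedisjoint`), and each translate is
brought back to `DG` by the left-invariant `μ` and the invariance of `φ`. -/
theorem R_eq_setIntegral_finiteKernel {f φ : G → ℂ} (hf : IsTest f) (hφ : S.Invariant φ)
    (hφc : Continuous φ) {C₁ : Set G} (Γ : Finset S.Gk)
    (hΓ : ∀ γ : S.Gk, (γ : G) ∈ C₁ * tsupport f * (closure S.DG)⁻¹ → γ ∈ Γ) {y : G} (hy : y ∈ C₁) :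
    S.R f φ y = ∫ z in S.DG, (∑ γ ∈ Γ, f (y⁻¹ * γ * z)) * φ z ∂S.μ := by
  haveI := S.haar
  rw [S.R_eq_integral_inv_mul]
  set F : G → ℂ := fun h => f (y⁻¹ * h) * φ h with hF
  have hFi : Integrable F S.μ := S.integrable_of_isTest ((hf.translate y).mul_continuous hφc)
  -- the union of the translates
  set U : Set G := ⋃ i : ↥Γ, ((i : S.Gk) • S.DG) with hU
  -- step a: `F` vanishes a.e. outside `U`
  have hae : ∀ᵐ h ∂S.μ, h ∉ U → F h = 0 := by
    filter_upwards [S.fdG.ae_covers] with h hh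
    intro hnot
    by_contra hne
    obtain ⟨g, hg⟩ := hh
    have hf0 : f (y⁻¹ * h) ≠ 0 := fun h0 => hne (by simp [hF, h0])
    have hK : y⁻¹ * h ∈ tsupport f := subset_tsupport f hf0
    -- `g⁻¹` lies in the window
    have hwin : ((g⁻¹ : S.Gk) : G) ∈ C₁ * tsupport f * (closure S.DG)⁻¹ := by
      have hgh : (g : G) * h ∈ closure S.DG := by
        rw [Subgroup.smul_def, smul_eq_mul] at hg
        exact subset_closure hg
      refine ⟨y * (y⁻¹ * h), ⟨y, hy, y⁻¹ * h, hK, rfl⟩, ((g : G) * h)⁻¹, Set.inv_mem_inv.mpr hgh, ?_⟩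
      simp only [Subgroup.coe_inv, mul_inv_rev]
      group
    have hmem : h ∈ U := by
      refine Set.mem_iUnion.mpr ⟨⟨g⁻¹, hΓ _ hwin⟩, ?_⟩
      refine ⟨g • h, hg, ?_⟩
      simp only [Subgroup.smul_def, smul_eq_mul, Subgroup.coe_inv]
      group
    exact hnot hmem
  rw [← setIntegral_eq_integral_of_ae_compl_eq_zero hae]
  -- step b: the finite a.e.-disjoint union
  have hb : ∫ h in U, F h ∂S.μ = ∑ i : ↥Γ, ∫ h in ((i : S.Gk) • S.DG), F h ∂S.μ := by
    rw [hU, integral_iUnion_ae (s := fun i : ↥Γ => ((i : S.Gk) • S.DG))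
      (fun i => S.fdG.nullMeasurableSet_smul _)
      (fun i j hij => S.fdG.aedisjoint (Subtype.val_injective.ne hij)) hFi.integrableOn]
    exact tsum_fintype _
  rw [hb]
  -- step c: each translate back to `DG`
  have hc : ∀ i : ↥Γ, ∫ h in ((i : S.Gk) • S.DG), F h ∂S.μ =
      ∫ z in S.DG, f (y⁻¹ * (i : S.Gk) * z) * φ z ∂S.μ := by
    intro i
    rw [S.setIntegral_smul_DG]
    congr 1
    ext z
    simp only [hF, ← mul_assoc, hφ (i : S.Gk) z]
  simp_rw [hc]
  -- step d: the sum of the integrals is the integral of the sum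
  rw [Finset.sum_coe_sort Γ (fun γ : S.Gk => ∫ z in S.DG, f (y⁻¹ * γ * z) * φ z ∂S.μ)]
  rw [← integral_finsetSum]
  · congr 1
    ext z
    rw [Finset.sum_mul]
  · intro γ _
    exact S.integrableOn_DG ((hf.cont.comp (continuous_const.mul continuous_id)).mul hφc)

end Setting

end RTF

end Summit.Ventures.HodgeRepro.Tier4.Line1
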